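import Summits.Parity.BatemanHorn.Theorems.AlmostPrimeZerosDefs
import Literature.NumberTheory.LFunctions.MertensConstant

/-!
# `SystemLSDRealSegment`, line `beta-thinned-root-kernel` — hypothesis (H2) of `stub_levinFainleib`
# is load-bearing, even at dimension `κ = 0`

Negative-side support for the crux `Summit.Parity.BatemanHorn.Theses.AlmostPrimeZeros.SystemLSDRealSegment`
(stmt-Parity-11292), registered stub `stub_levinFainleib : ∀ g κ, LevinFainleibAsymp g κ` of the checked skeleton
`Cruxes/SystemLSDRealSegment/Lines/beta-thinned-root-kernel.lean` (predicate in `Theorems/AlmostPrimeZerosDefs.lean`).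

`LevinFainleibAsymp g κ` (Levin–Faĭnleĭb / Halberstam–Richert Lemma 5.4 / Ramaré Thm 13.3, asymptotic form) has two
analytic hypotheses: (H1) `|Σ_{p ≤ Q} g(p) log p − κ log Q| ≤ L` and (H2) bounded partial sums of
`Σ_p g(p)² log p + Σ_p Σ_{ν ≥ 2} g(p^ν) log p^ν`.  Downstream (`stub_typeILimit`) (H2) is fed by conjunct (6) of
`TypeILocal` (`b(p^ν) ≤ C/p²`, the Hensel / no-common-root input `LocalCounts`).  This file shows that (H2) cannot be
dropped from the stub: the predicate with (H2) deleted (otherwise verbatim, inlined below) FAILS for the non-negative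
multiplicative witness `g(n) = ∏_{p^v ∥ n} c(p, v)`, `c(p,2) = 1/p`, `c(p,0) = 1`, `c = 0` otherwise (so `g(p²) = 1/p`,
`g(p^ν) = 0` for `ν ∉ {0, 2}`) at `κ = 0`: (H1) holds with `L = 0`, but the ordered product
`∏_{p ≤ N} (Σ_ν g(p^ν))(1 − 1/p)^0 = ∏_{p ≤ N} (1 + 1/p) ≥ 1 + Σ_{p ≤ N} 1/p → ∞`
(Mertens, `Literature.NumberTheory.LFunctions.Mertens.tendsto_primeRecipSum_sub_loglog`), so no limit `P` exists
(`levinFainleib_false_without_H2`; the witness is built inside the proof — no new definitions).  Equivalently: the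
prime-square control of the Type-I coefficient is not cosmetic.
-/

open Filter Finset
open scoped Topology BigOperators

namespace Summit.Parity.BatemanHorn.Theorems.SystemLSDRealSegment.Negative

open Summit.Parity.BatemanHorn.Cruxes.SystemLSDRealSegment.BetaThinnedRootKernel

/-- Sanity link: the statement refuted below is `LevinFainleibAsymp g κ` with hypothesis (H2) deleted and every
other clause verbatim — adding (H2) back as an (unused) hypothesis gives the stub's predicate. [folklore] -/
theorem levinFainleibAsymp_of_withoutH2 {g : ℕ → ℝ} {κ : ℝ}
    (h : 0 ≤ κ → (∀ n, 0 ≤ g n) → g 1 = 1 →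
      (∀ m n : ℕ, m.Coprime n → g (m * n) = g m * g n) →
      (∃ L : ℝ, ∀ Q : ℕ, 2 ≤ Q →
        |(∑ p ∈ Nat.primesLE Q, g p * Real.log p) - κ * Real.log Q| ≤ L) →
      ∃ P : ℝ,
        Tendsto (fun N : ℕ => ∏ p ∈ Nat.primesLE N, (∑' ν : ℕ, g (p ^ ν)) * (1 - 1 / (p : ℝ)) ^ κ)
          atTop (𝓝 P) ∧
        Tendsto (fun D : ℕ => (∑ d ∈ Icc 1 D, g d) / Real.log D ^ κ) atTop
          (𝓝 (P / Real.Gamma (κ + 1)))) :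
    LevinFainleibAsymp g κ :=
  fun h0 h1 h2 h3 h4 _ => h h0 h1 h2 h3 h4

/-! ### Two witness-free engines -/

/-- `1 + Σ a ≤ ∏ (1 + a)` for non-negative `a`. [folklore] -/
theorem one_add_sum_le_prod_one_add_real (s : Finset ℕ) {a : ℕ → ℝ} (ha : ∀ i, 0 ≤ a i) :
    1 + ∑ i ∈ s, a i ≤ ∏ i ∈ s, (1 + a i) := by
  induction s using Finset.induction_on with
  | empty => simp
  | @insert j s hj ih =>
    rw [Finset.sum_insert hj, Finset.prod_insert hj]
    have h1 : 1 ≤ ∏ i ∈ s, (1 + a i) :=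
      le_trans (le_add_of_nonneg_right (Finset.sum_nonneg fun i _ => ha i)) ih
    nlinarith [ha j, ih, h1]

/-- `Σ_{p ≤ N} 1/p → ∞` along the integers (Mertens' second theorem, from the literature tree). [folklore] -/
theorem tendsto_sum_primesLE_inv_atTop :
    Tendsto (fun N : ℕ => ∑ p ∈ Nat.primesLE N, (p : ℝ)⁻¹) atTop atTop := by
  have h1 : Tendsto (fun x : ℝ => Literature.NumberTheory.LFunctions.Mertens.primeRecipSum x) atTop atTop := by
    have hll : Tendsto (fun x : ℝ => Real.log (Real.log x)) atTop atTop :=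
      Real.tendsto_log_atTop.comp Real.tendsto_log_atTop
    have := (Literature.NumberTheory.LFunctions.Mertens.tendsto_primeRecipSum_sub_loglog).add_atTop hll
    exact this.congr fun x => by ring
  have h2 := h1.comp tendsto_natCast_atTop_atTop
  refine h2.congr fun N => ?_
  simp [Function.comp, Literature.NumberTheory.LFunctions.Mertens.primeRecipSum, Nat.floor_natCast]

/-! ### The refutation -/

/-- **(H2) is load-bearing in `stub_levinFainleib`**: with (H2) deleted the Levin–Faĭnleĭb statement is false.
Witness (built in the proof) `g(n) = ∏_{p^v ∥ n} c(p,v)` with `c(p,0) = 1`, `c(p,2) = 1/p`, `c = 0` otherwise, and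
`κ = 0`: `g ≥ 0`, `g(1) = 1`, multiplicative, (H1) with `L = 0` (`g(p) = 0`), while
`∏_{p≤N} (Σ_ν g(p^ν))(1−1/p)^0 = ∏_{p≤N}(1 + 1/p) ≥ 1 + Σ_{p≤N} 1/p → ∞` has no limit. [folklore] -/
theorem levinFainleib_false_without_H2 :
    ¬ ∀ (g : ℕ → ℝ) (κ : ℝ), 0 ≤ κ → (∀ n, 0 ≤ g n) → g 1 = 1 →
      (∀ m n : ℕ, m.Coprime n → g (m * n) = g m * g n) →
      (∃ L : ℝ, ∀ Q : ℕ, 2 ≤ Q →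
        |(∑ p ∈ Nat.primesLE Q, g p * Real.log p) - κ * Real.log Q| ≤ L) →
      ∃ P : ℝ,
        Tendsto (fun N : ℕ => ∏ p ∈ Nat.primesLE N, (∑' ν : ℕ, g (p ^ ν)) * (1 - 1 / (p : ℝ)) ^ κ)
          atTop (𝓝 P) ∧
        Tendsto (fun D : ℕ => (∑ d ∈ Icc 1 D, g d) / Real.log D ^ κ) atTop
          (𝓝 (P / Real.Gamma (κ + 1))) := by
  intro h
  -- the witness and its local coefficients
  set c : ℕ → ℕ → ℝ := fun p v => if v = 2 then ((p : ℝ))⁻¹ else if v = 0 then 1 else 0 with hc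
  set g : ℕ → ℝ := fun n => n.factorization.prod fun p v => c p v with hg
  have hc0 : ∀ p v, 0 ≤ c p v := fun p v => by
    simp only [hc]
    split_ifs <;> positivity
  have hg0 : ∀ n, 0 ≤ g n := fun n => by
    simp only [hg, Finsupp.prod]
    exact Finset.prod_nonneg fun p _ => hc0 p _
  have hg1 : g 1 = 1 := by simp [hg]
  have hgpow : ∀ {p : ℕ}, p.Prime → ∀ ν : ℕ, g (p ^ ν) = c p ν := fun {p} hp ν => by
    simp only [hg]
    rw [hp.factorization_pow, Finsupp.prod_single_index]
    simp [hc]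
  have hgp : ∀ {p : ℕ}, p.Prime → g p = 0 := fun {p} hp => by
    have := hgpow hp 1
    rw [pow_one] at this
    rw [this]
    simp [hc]
  have hgmul : ∀ m n : ℕ, m.Coprime n → g (m * n) = g m * g n := by
    intro m n hmn
    rcases eq_or_ne m 0 with rfl | hm
    · rw [Nat.coprime_zero_left] at hmn
      subst hmn
      rw [mul_one, hg1, mul_one]
    rcases eq_or_ne n 0 with rfl | hn
    · rw [Nat.coprime_zero_right] at hmn
      subst hmn
      rw [one_mul, hg1, one_mul]
    simp only [hg]
    rw [Nat.factorization_mul hm hn, Finsupp.prod_add_index_of_disjoint]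
    simpa only [Nat.support_factorization] using hmn.disjoint_primeFactors
  have htsum : ∀ {p : ℕ}, p.Prime → ∑' ν : ℕ, g (p ^ ν) = 1 + (p : ℝ)⁻¹ := fun {p} hp => by
    simp_rw [hgpow hp]
    rw [tsum_eq_sum (s := ({0, 2} : Finset ℕ))]
    · rw [Finset.sum_pair (by norm_num)]
      simp [hc]
    · intro ν hν
      simp only [Finset.mem_insert, Finset.mem_singleton, not_or] at hν
      simp [hc, hν.1, hν.2]
  -- divergence of the ordered product at κ = 0
  have hprod : Tendsto (fun N : ℕ => ∏ p ∈ Nat.primesLE N, (∑' ν : ℕ, g (p ^ ν)) * (1 - 1 / (p : ℝ)) ^ (0 : ℝ))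
      atTop atTop := by
    have heq : ∀ N : ℕ, (∏ p ∈ Nat.primesLE N, (∑' ν : ℕ, g (p ^ ν)) * (1 - 1 / (p : ℝ)) ^ (0 : ℝ)) =
        ∏ p ∈ Nat.primesLE N, (1 + (p : ℝ)⁻¹) := fun N =>
      Finset.prod_congr rfl fun p hp => by
        rw [Real.rpow_zero, mul_one, htsum (Nat.mem_primesLE.1 hp).2]
    simp_rw [heq]
    refine tendsto_atTop_mono (fun N => ?_) (tendsto_atTop_add_const_left _ 1 tendsto_sum_primesLE_inv_atTop)
    exact one_add_sum_le_prod_one_add_real _ fun i => by positivity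
  -- (H1) with L = 0, and the contradiction
  have hH1 : ∃ L : ℝ, ∀ Q : ℕ, 2 ≤ Q →
      |(∑ p ∈ Nat.primesLE Q, g p * Real.log p) - 0 * Real.log Q| ≤ L := by
    refine ⟨0, fun Q _ => ?_⟩
    rw [Finset.sum_eq_zero fun p hp => by rw [hgp (Nat.mem_primesLE.1 hp).2, zero_mul],
      zero_mul, sub_zero, abs_zero]
  obtain ⟨P, hP, -⟩ := h g 0 le_rfl hg0 hg1 hgmul hH1
  exact not_tendsto_nhds_of_tendsto_atTop hprod P hP

end Summit.Parity.BatemanHorn.Theorems.SystemLSDRealSegment.Negative
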